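import Summits.QuantumFields.BalabanUV.T4Continuum.Support.NE3CoercivityScalingPrep
import Summits.QuantumFields.BalabanUV.T4Continuum.Support.NE3TangentNoGoFlat
import Summits.QuantumFields.BalabanUV.T4Continuum.Support.NE3EnergyWeightedShapes
import HarnessLib

/-!
# T⁴ programme, node NE3 — THE SLICE LIFT IS A CURL-CONTROLLED EXACT RIGHT INVERSE OF THE FLAT LINEARISED AVERAGE:
# `d₁(sliceLift φ)` is the coarse curl `d₁φ` transplanted to the corner slices, so `curlSq₁(sliceLift φ) = L^{d−2}·curlSq₁(φ)`,
# `dirSq(sliceLift φ) = L^{d−1}·dirSq(φ)`, and the lift is bounded level-to-level in the η-WEIGHTED energy norm (flat core of (RES♯))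

NE3 prover lineage P1, gen 20 (cell `pub-balaban`, unit `b2b-balaban-t4-ne3-p1`, row NE3 OWNER).  CONTEXT (skeleton v1.10 §4b row
E-RES♯; repair census G-ne3p1-g19-1 (R2)∕(R3)): the local half of NE3 hangs on (RES♯) `NE3EnergyWeightedShapes.CurlPairedResidual` — the
dual residual of the averaged competitor paired with the CURL of the test direction.  Row NE3-R2's residual as proved
(`AveragingDeficitDualResidual.dualResidual_torus`) pairs the flux-gradient term with `‖φ‖_ℓ²` because the deficit-derivative wall (β)
consumes a FINE lift `ψ` of the coarse direction `φ` through `‖d_V ψ‖_ℓ²`, and the lift used there (`AveragingDeficitFaceLift.faceLift`: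
ONE fine bond per coarse bond, weight `2L^d`) has fine curl of size `‖φ‖`, not `‖dφ‖`.  THIS FILE shows that the tree's SLICE LIFT
(`SmoothRefineBlocks.sliceLift L φ (y, μ) = φ (blk y) μ` on the last `μ`-slice `res_μ y = L−1` of each block, else `0`; exact right
inverse of the flat contour average: `SmoothRefineNeutral.Tside_sliceLift`) IS curl-controlled at the flat background:

* §1 `curlAt_flatCfg_eq_asum` (the flat dressed curl is the plaquette contour sum), **`curlAt_flatCfg_sliceLift`**: the flat curl of
  `sliceLift L φ` at `y` is the flat curl of `φ` at `blk y` if `y` lies on the CORNER SLICE (`res_μ y = res_ν y = L−1`) and `0`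
  otherwise (the tree's `SmoothRefineSlices.asum_sliceLift_plaqWord`);
* §2 counting: the corner slice of a block has `L^{d−2}` sites per plane, the last slice `L^{d−1}` sites;
* §3 THE TRANSPLANT IDENTITIES on the period torus (`M ≥ 1`, `L ≥ 1`, `d ≥ 2`): **`curlSq_flatCfg_sliceLift`**
  `curlSq 1 (sliceLift L φ) (periodBox (L·M)) = L^{d−2}·curlSq 1 φ (periodBox M)`, `curlL1_flatCfg_sliceLift` (factor `L^{d−2}`),
  **`dirSq_sliceLift`** (factor `L^{d−1}`), `dirL1_sliceLift` (factor `L^{d−1}`);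
* §4 the lift is an EXACT right inverse of the flat coarse push-forward (`cpush_flatCfg_sliceLift : cpush L flatCfg (sliceLift L φ) = φ`),
  maps skew to skew and period `M` to period `L·M`, and maps the `k`-fold flat tangent space INTO the `(k+1)`-fold one
  (`tangentIter_flatCfg_sliceLift_iff : TangentIter L (j+1) flatCfg (sliceLift L φ) ↔ TangentIter L j flatCfg φ`);
* §5 **`energyNormW_sliceLift_le`**: `energyNormW L (k+1) 1 (sliceLift L φ) (periodBox (L·M)) ≤ L^{(d−2)/2}… ` precisely
  `energyNormW L (k+1) 1 (sliceLift L φ) (periodBox (L·M))² ≤ L^{d−2}·energyNormW L k 1 φ (periodBox M)²` — the lift from run A's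
  level-`k` lattice to run B's level-`(k+1)` lattice is BOUNDED IN THE η-WEIGHTED ENERGY NORM with the k-FREE constant `L^{d−2}`.

WHAT THIS GIVES THE ROW (docstring-level, nothing below depends on it): with a curl-controlled lift the β-wall's leading term
`wallConst·‖∇_V F‖_ℓ²·‖d_V ψ‖_ℓ²` pairs with `L^{(d−2)/2}·‖d_W φ‖_ℓ² ≤ L^{(d−2)/2}·energyNormW(φ)`, which IS the (RES♯) pairing; the
non-flat background `V = U_B` adds (in block-axial gauges, where in-block bond variables are `1 + O(L²a)` and the slice bonds carry
the block transfer matrices ≈ the coarse bond variables) an `O(L²a)·‖φ‖` defect, correctable by NE3-R2's face lift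
(`AveragingDeficitFaceLift.exists_lift_of_smallField`) at an `a`-weighted cost — the harmless terms (R3) allows.  That non-flat step
is NOT done here.

HONEST FRAMING.  Exact finite-`T⁴` lattice identities at the FLAT configuration (our frame); nothing about Bałaban's minimisers is
asserted; (RES♯), (ML_w), T-E_w♯ NOT proved; NE3 NOT proved; spine PROVED 0∕9; finite T⁴ rung (B)+1 — NOT infinite volume, NOT mass
gap, NOT `BetaPertH`, NOT Clay.  No `def`, no `sorry`.  PLACEMENT: `Summits/QuantumFields/BalabanUV/`.  HONEST DEPENDENCY (cell page
1): continuum YM on T⁴ ⇐ BetaPertH ∧ nine spine estimates (0/9 proved); BetaPertH ⇐ (D1) ∧ (D4) ∧ CAP+tail; G-an2-4 gates asym, D1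
and NE2/3/4.
-/

set_option autoImplicit false

open scoped BigOperators Matrix Matrix.Norms.L2Operator
open Finset

namespace Summit.QuantumFields.BalabanUV.T4Continuum.NE3SliceLiftCurl

open Literature.MathematicalPhysics.QuantumFieldTheory.Balaban1983to89
open B7Prop1Explicit B7Prop2Explicit
open T4AveragingDeficitWall hiding Site Plane Plaq Bond
open T4AveragingDeficitWallBoundary (periodBox blockSites_periodBox sum_blocks_eq)
open AveragingDeficitPeriodicCounting (IsPeriodicDir)
open AveragingDeficitMultiLevelPrep (TangentIter cpush)
open AveragingDeficitChartCalculus (cavg)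
open MinimalActionWitness (flatCfg)
open SmoothRefineBlocks (blk res sliceLift sliceLift_of_ne sliceLift_of_eq blk_boxVec res_boxVec sliceLift_add_period)
open SmoothRefineSlices (asum_sliceLift_plaqWord)
open SmoothRefineNeutral (Tcoarse Tside_sliceLift)
open NE3CoercivityScalingPrep (flatCfg_apply Ad_one)
open NE3TangentNoGoWords (sum_two_coord)
open NE3TangentFlatPush (sum_fun_apply_eq flatCfg_eq_flat cavg_flatCfg)
open NE3TangentNoGoFlat (cpush_flat)
open NE3EnergyWeightedShapes (energyNormW energyNormW_nonneg)

noncomputable section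

variable {d : ℕ} {n : Type*} [Fintype n] [DecidableEq n]

/-! ## §1 The flat curl of a slice lift is the transplanted coarse curl -/

/-- At the flat configuration the dressed curl is the plaquette contour sum:
`curlAt 1 ψ z μ ν = ψ z μ + ψ (z+e_μ) ν − ψ (z+e_ν) μ − ψ z ν = asum ψ z (plaqWord μ ν)`. [folklore] -/
theorem curlAt_flatCfg_eq_asum (ψ : Site d → Fin d → Matrix n n ℂ) (z : Site d) (μ ν : Fin d) :
    curlAt (flatCfg (d := d) (n := n)) ψ z μ ν = asum ψ z (plaqWord μ ν) := by
  rw [asum_plaqWord]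
  simp [curlAt, flatCfg_apply, Ad_one]

/-- **THE FLAT CURL OF THE SLICE LIFT**: for `μ ≠ ν` and `L ≥ 1`, `curlAt 1 (sliceLift L φ) y μ ν` is `curlAt 1 φ (blk y) μ ν` if `y`
lies on the corner slice `res_μ y = res_ν y = L − 1` of its block, and `0` otherwise (the coarse curl transplanted). [folklore] -/
theorem curlAt_flatCfg_sliceLift {L : ℕ} (hL : 1 ≤ L) (φ : Site d → Fin d → Matrix n n ℂ) (y : Site d) {μ ν : Fin d}
    (hμν : μ ≠ ν) :
    curlAt (flatCfg (d := d) (n := n)) (sliceLift L φ) y μ ν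
      = if res L y μ = (L : ℤ) - 1 ∧ res L y ν = (L : ℤ) - 1 then curlAt (flatCfg (d := d) (n := n)) φ (blk L y) μ ν else 0 := by
  rw [curlAt_flatCfg_eq_asum, curlAt_flatCfg_eq_asum, asum_sliceLift_plaqWord hL φ y hμν]

/-- The same on the block parametrisation `y = L•z + r`, `r ∈ [0,L)^d`: the condition reads `r_μ = r_ν = L − 1`, the block is `z`.
[folklore] -/
theorem curlAt_flatCfg_sliceLift_block {L : ℕ} (hL : 1 ≤ L) (φ : Site d → Fin d → Matrix n n ℂ) (z : Site d)
    (r : Fin d → Fin L) {μ ν : Fin d} (hμν : μ ≠ ν) :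
    curlAt (flatCfg (d := d) (n := n)) (sliceLift L φ) ((L : ℤ) • z + boxVec L r) μ ν
      = if ((r μ : ℕ) : ℤ) = (L : ℤ) - 1 ∧ ((r ν : ℕ) : ℤ) = (L : ℤ) - 1 then curlAt (flatCfg (d := d) (n := n)) φ z μ ν
        else 0 := by
  rw [curlAt_flatCfg_sliceLift hL φ _ hμν, res_boxVec hL, blk_boxVec hL]
  rfl

omit [Fintype n] [DecidableEq n] in
/-- The slice lift on the block parametrisation: `sliceLift L φ (L•z + r) μ = φ z μ` if `r_μ = L − 1`, else `0`. [folklore] -/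
theorem sliceLift_block {L : ℕ} (hL : 1 ≤ L) (φ : Site d → Fin d → Matrix n n ℂ) (z : Site d) (r : Fin d → Fin L)
    (μ : Fin d) :
    sliceLift L φ ((L : ℤ) • z + boxVec L r) μ = if ((r μ : ℕ) : ℤ) = (L : ℤ) - 1 then φ z μ else 0 := by
  unfold SmoothRefineBlocks.sliceLift
  rw [res_boxVec hL, blk_boxVec hL]
  rfl

/-! ## §2 Counting the slices -/

omit [Fintype n] [DecidableEq n] in
/-- The indicator of the last residue sums to `1` over `Fin L` (`L ≥ 1`). [folklore] -/
theorem sum_lastInd {L : ℕ} (hL : 1 ≤ L) :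
    ∑ a : Fin L, (if ((a : ℕ) : ℤ) = (L : ℤ) - 1 then (1 : ℝ) else 0) = 1 := by
  have key : ∀ a : Fin L, (((a : ℕ) : ℤ) = (L : ℤ) - 1) ↔ a = ⟨L - 1, by omega⟩ := by
    intro a
    constructor
    · intro h; ext; simp only; omega
    · intro h; subst h; simp only; omega
  simp_rw [key]
  rw [Finset.sum_ite_eq' Finset.univ (⟨L - 1, by omega⟩ : Fin L) (fun _ => (1 : ℝ))]
  simp

omit [Fintype n] [DecidableEq n] in
/-- **Corner slices have `L^{d−2}` sites per block and plane**: for `d = m + 2` and `μ ≠ ν`,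
`Σ_{r : [0,L)^d} [r_μ = L−1]·[r_ν = L−1]·c = L^{d−2}·c`. [folklore] -/
theorem sum_cornerInd {m L : ℕ} (hL : 1 ≤ L) {μ ν : Fin (m + 2)} (hμν : μ ≠ ν) (c : ℝ) :
    ∑ r : Fin (m + 2) → Fin L,
        (if ((r μ : ℕ) : ℤ) = (L : ℤ) - 1 ∧ ((r ν : ℕ) : ℤ) = (L : ℤ) - 1 then c else 0)
      = (L : ℝ) ^ m * c := by
  have h := sum_two_coord (M := ℝ) m L hμν (fun a => if ((a : ℕ) : ℤ) = (L : ℤ) - 1 then (1 : ℝ) else 0)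
    (fun a => if ((a : ℕ) : ℤ) = (L : ℤ) - 1 then c else 0)
  have e : ∀ r : Fin (m + 2) → Fin L,
      ((if ((r μ : ℕ) : ℤ) = (L : ℤ) - 1 then (1 : ℝ) else 0) • (if ((r ν : ℕ) : ℤ) = (L : ℤ) - 1 then c else 0))
        = (if ((r μ : ℕ) : ℤ) = (L : ℤ) - 1 ∧ ((r ν : ℕ) : ℤ) = (L : ℤ) - 1 then c else 0) := by
    intro r
    by_cases h1 : ((r μ : ℕ) : ℤ) = (L : ℤ) - 1 <;> by_cases h2 : ((r ν : ℕ) : ℤ) = (L : ℤ) - 1 <;> simp [h1, h2]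
  simp_rw [e] at h
  rw [h, sum_lastInd hL]
  have e2 : ∑ a : Fin L, (if ((a : ℕ) : ℤ) = (L : ℤ) - 1 then c else 0)
      = c * ∑ a : Fin L, (if ((a : ℕ) : ℤ) = (L : ℤ) - 1 then (1 : ℝ) else 0) := by
    rw [Finset.mul_sum]
    refine Finset.sum_congr rfl fun a _ => ?_
    split_ifs <;> simp
  rw [e2, sum_lastInd hL]
  simp [smul_eq_mul]

omit [Fintype n] [DecidableEq n] in
/-- **Last slices have `L^{d−1}` sites per block**: `Σ_{r : [0,L)^d} [r_μ = L−1]·c = L^{d−1}·c` (`L ≥ 1`). [folklore] -/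
theorem sum_sliceInd {L : ℕ} (hL : 1 ≤ L) (μ : Fin d) (c : ℝ) :
    ∑ r : Fin d → Fin L, (if ((r μ : ℕ) : ℤ) = (L : ℤ) - 1 then c else 0) = (L : ℝ) ^ (d - 1) * c := by
  rw [sum_fun_apply_eq L μ (fun a => if ((a : ℕ) : ℤ) = (L : ℤ) - 1 then c else 0)]
  congr 1
  have e2 : ∑ a : Fin L, (if ((a : ℕ) : ℤ) = (L : ℤ) - 1 then c else 0)
      = c * ∑ a : Fin L, (if ((a : ℕ) : ℤ) = (L : ℤ) - 1 then (1 : ℝ) else 0) := by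
    rw [Finset.mul_sum]
    refine Finset.sum_congr rfl fun a _ => ?_
    split_ifs <;> simp
  rw [e2, sum_lastInd hL, mul_one]

/-! ## §3 The transplant identities on the period torus -/

/-- **`curlSq 1 (sliceLift L φ) (periodBox (L·M)) = L^{d−2}·curlSq 1 φ (periodBox M)`** (`d ≥ 2`, `L ≥ 1`): the flat curl energy
of the slice lift is the coarse curl energy times the number `L^{d−2}` of corner-slice sites per block and plane. [folklore] -/
theorem curlSq_flatCfg_sliceLift (hd : 2 ≤ d) {L : ℕ} (hL : 1 ≤ L) (M : ℕ) (φ : Site d → Fin d → Matrix n n ℂ) :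
    curlSq (flatCfg (d := d) (n := n)) (sliceLift L φ) (periodBox (L * M))
      = (L : ℝ) ^ (d - 2) * curlSq (flatCfg (d := d) (n := n)) φ (periodBox M) := by
  obtain ⟨m, rfl⟩ : ∃ m, d = m + 2 := ⟨d - 2, by omega⟩
  unfold curlSq
  rw [← blockSites_periodBox L M hL, ← sum_blocks_eq L hL (periodBox M), Finset.mul_sum]
  refine Finset.sum_congr rfl fun z _ => ?_
  -- per block: Σ_r Σ_π ‖curl (sliceLift φ) (L•z + r, π)‖² = L^m · Σ_π ‖curl φ (z, π)‖²
  have e : ∀ r : Fin (m + 2) → Fin L, ∑ π : T4AveragingDeficitWall.Plane (m + 2),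
      ‖curl (flatCfg (d := m + 2) (n := n)) (sliceLift L φ) (((L : ℤ) • z + boxVec L r), π)‖ ^ 2
      = ∑ π : T4AveragingDeficitWall.Plane (m + 2),
        (if ((r π.1.1 : ℕ) : ℤ) = (L : ℤ) - 1 ∧ ((r π.1.2 : ℕ) : ℤ) = (L : ℤ) - 1
          then ‖curl (flatCfg (d := m + 2) (n := n)) φ (z, π)‖ ^ 2 else 0) := by
    intro r
    refine Finset.sum_congr rfl fun π _ => ?_
    unfold curl
    rw [curlAt_flatCfg_sliceLift_block hL φ z r (ne_of_lt π.2)]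
    split_ifs <;> simp
  simp_rw [e]
  rw [Finset.sum_comm, Finset.mul_sum]
  refine Finset.sum_congr rfl fun π _ => ?_
  rw [sum_cornerInd hL (ne_of_lt π.2)]
  simp

/-- The `ℓ¹` twin: `curlL1 1 (sliceLift L φ) (periodBox (L·M)) = L^{d−2}·curlL1 1 φ (periodBox M)`. [folklore] -/
theorem curlL1_flatCfg_sliceLift (hd : 2 ≤ d) {L : ℕ} (hL : 1 ≤ L) (M : ℕ) (φ : Site d → Fin d → Matrix n n ℂ) :
    curlL1 (flatCfg (d := d) (n := n)) (sliceLift L φ) (periodBox (L * M))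
      = (L : ℝ) ^ (d - 2) * curlL1 (flatCfg (d := d) (n := n)) φ (periodBox M) := by
  obtain ⟨m, rfl⟩ : ∃ m, d = m + 2 := ⟨d - 2, by omega⟩
  unfold curlL1
  rw [← blockSites_periodBox L M hL, ← sum_blocks_eq L hL (periodBox M), Finset.mul_sum]
  refine Finset.sum_congr rfl fun z _ => ?_
  have e : ∀ r : Fin (m + 2) → Fin L, ∑ π : T4AveragingDeficitWall.Plane (m + 2),
      ‖curl (flatCfg (d := m + 2) (n := n)) (sliceLift L φ) (((L : ℤ) • z + boxVec L r), π)‖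
      = ∑ π : T4AveragingDeficitWall.Plane (m + 2),
        (if ((r π.1.1 : ℕ) : ℤ) = (L : ℤ) - 1 ∧ ((r π.1.2 : ℕ) : ℤ) = (L : ℤ) - 1
          then ‖curl (flatCfg (d := m + 2) (n := n)) φ (z, π)‖ else 0) := by
    intro r
    refine Finset.sum_congr rfl fun π _ => ?_
    unfold curl
    rw [curlAt_flatCfg_sliceLift_block hL φ z r (ne_of_lt π.2)]
    split_ifs <;> simp
  simp_rw [e]
  rw [Finset.sum_comm, Finset.mul_sum]
  refine Finset.sum_congr rfl fun π _ => ?_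
  rw [sum_cornerInd hL (ne_of_lt π.2)]
  simp

/-- **`dirSq (sliceLift L φ) (periodBox (L·M)) = L^{d−1}·dirSq φ (periodBox M)`** (`L ≥ 1`): the bond energy of the slice lift is
the coarse bond energy times the `L^{d−1}` sites of a last slice. [folklore] -/
theorem dirSq_sliceLift {L : ℕ} (hL : 1 ≤ L) (M : ℕ) (φ : Site d → Fin d → Matrix n n ℂ) :
    dirSq (sliceLift L φ) (periodBox (L * M)) = (L : ℝ) ^ (d - 1) * dirSq φ (periodBox M) := by
  unfold dirSq
  rw [← blockSites_periodBox L M hL, ← sum_blocks_eq L hL (periodBox M), Finset.mul_sum]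
  refine Finset.sum_congr rfl fun z _ => ?_
  have e : ∀ r : Fin d → Fin L, ∑ κ : Fin d, ‖sliceLift L φ ((L : ℤ) • z + boxVec L r) κ‖ ^ 2
      = ∑ κ : Fin d, (if ((r κ : ℕ) : ℤ) = (L : ℤ) - 1 then ‖φ z κ‖ ^ 2 else 0) := by
    intro r
    refine Finset.sum_congr rfl fun κ _ => ?_
    rw [sliceLift_block hL]
    split_ifs <;> simp
  simp_rw [e]
  rw [Finset.sum_comm]
  simp_rw [sum_sliceInd hL]
  rw [← Finset.mul_sum]

/-- The `ℓ¹` twin: `dirL1 (sliceLift L φ) (periodBox (L·M)) = L^{d−1}·dirL1 φ (periodBox M)`. [folklore] -/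
theorem dirL1_sliceLift {L : ℕ} (hL : 1 ≤ L) (M : ℕ) (φ : Site d → Fin d → Matrix n n ℂ) :
    dirL1 (sliceLift L φ) (periodBox (L * M)) = (L : ℝ) ^ (d - 1) * dirL1 φ (periodBox M) := by
  unfold dirL1
  rw [← blockSites_periodBox L M hL, ← sum_blocks_eq L hL (periodBox M), Finset.mul_sum]
  refine Finset.sum_congr rfl fun z _ => ?_
  have e : ∀ r : Fin d → Fin L, ∑ κ : Fin d, ‖sliceLift L φ ((L : ℤ) • z + boxVec L r) κ‖
      = ∑ κ : Fin d, (if ((r κ : ℕ) : ℤ) = (L : ℤ) - 1 then ‖φ z κ‖ else 0) := by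
    intro r
    refine Finset.sum_congr rfl fun κ _ => ?_
    rw [sliceLift_block hL]
    split_ifs <;> simp
  simp_rw [e]
  rw [Finset.sum_comm]
  simp_rw [sum_sliceInd hL]
  rw [← Finset.mul_sum]

/-! ## §4 Exact right inverse of the flat push-forward; skewness, periodicity, tangency -/

/-- **THE SLICE LIFT IS AN EXACT RIGHT INVERSE OF THE FLAT COARSE PUSH-FORWARD**: `cpush L 1 (sliceLift L φ) = φ` (`L ≥ 1`) — the
tree's `Tside_sliceLift` read through `cpush_flat`. [folklore] -/
theorem cpush_flatCfg_sliceLift {L : ℕ} (hL : 1 ≤ L) (φ : Site d → Fin d → Matrix n n ℂ) :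
    cpush L (flatCfg (d := d) (n := n)) (sliceLift L φ) = φ := by
  rw [flatCfg_eq_flat, cpush_flat L hL]
  funext z κ
  exact Tside_sliceLift hL φ z κ

omit [Fintype n] [DecidableEq n] in
/-- The slice lift of a skew direction is skew. [folklore] -/
theorem isSkewDir_sliceLift (L : ℕ) {φ : Site d → Fin d → Matrix n n ℂ} (hφ : IsSkewDir φ) : IsSkewDir (sliceLift L φ) := by
  intro y μ
  unfold SmoothRefineBlocks.sliceLift
  split_ifs
  · exact hφ _ _
  · exact (skewAdjoint _).zero_mem

omit [Fintype n] [DecidableEq n] in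
/-- The slice lift of an `M`-periodic direction is `L·M`-periodic (`L ≥ 1`). [folklore] -/
theorem isPeriodicDir_sliceLift {L : ℕ} (hL : 1 ≤ L) {M : ℕ} {φ : Site d → Fin d → Matrix n n ℂ}
    (hφ : IsPeriodicDir φ (M : ℤ)) : IsPeriodicDir (sliceLift L φ) ((L * M : ℕ) : ℤ) := by
  intro y κ μ
  have h := sliceLift_add_period hL φ (P := (M : ℤ)) (fun z κ μ => hφ z κ μ) y κ μ
  push_cast
  exact h

/-- **THE SLICE LIFT MAPS THE `j`-FOLD FLAT TANGENT SPACE INTO THE `(j+1)`-FOLD ONE, AND ONLY IT**: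
`TangentIter L (j+1) 1 (sliceLift L φ) ↔ TangentIter L j 1 φ` (the recursion `TangentIter (j+1) W ψ := TangentIter j (cavg W) (cpush W ψ)`
with `cavg 1 = 1` and §4's right inverse). [folklore] -/
theorem tangentIter_flatCfg_sliceLift_iff {L : ℕ} (hL : 1 ≤ L) (j : ℕ) (φ : Site d → Fin d → Matrix n n ℂ) :
    TangentIter L (j + 1) (flatCfg (d := d) (n := n)) (sliceLift L φ) ↔ TangentIter L j (flatCfg (d := d) (n := n)) φ := by
  show TangentIter L j (cavg L flatCfg) (cpush L flatCfg (sliceLift L φ)) ↔ _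
  rw [cavg_flatCfg, cpush_flatCfg_sliceLift hL]

/-! ## §5 The lift is bounded level-to-level in the η-weighted energy norm -/

/-- **THE SLICE LIFT IS BOUNDED IN THE η-WEIGHTED ENERGY NORM ACROSS ONE LEVEL** (`d ≥ 2`, `L ≥ 1`): reading `φ` on run A's lattice of
level `k` (weight `(L^k)⁻²` on `dirSq`) and its lift on run B's lattice of level `k+1` (weight `(L^{k+1})⁻²`),
`energyNormW L (k+1) 1 (sliceLift L φ) (periodBox (L·M))² ≤ L^{d−2}·energyNormW L k 1 φ (periodBox M)²`
(§3: the curl part is EXACTLY `L^{d−2}×`, the bond part is `L^{d−1}·(L^{k+1})⁻² = L^{d−2}·L⁻¹·(L^k)⁻² ≤ L^{d−2}·(L^k)⁻²`). [folklore] -/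
theorem energyNormW_sliceLift_sq_le (hd : 2 ≤ d) {L : ℕ} (hL : 1 ≤ L) (M k : ℕ) (φ : Site d → Fin d → Matrix n n ℂ) :
    energyNormW L (k + 1) (flatCfg (d := d) (n := n)) (sliceLift L φ) (periodBox (L * M)) ^ 2
      ≤ (L : ℝ) ^ (d - 2) * energyNormW L k (flatCfg (d := d) (n := n)) φ (periodBox M) ^ 2 := by
  have hL1 : (1 : ℝ) ≤ L := by exact_mod_cast hL
  have hL0 : (0 : ℝ) < L := by linarith
  -- `energyNormW² = curlSq + weight·dirSq`
  have eW : ∀ (j : ℕ) (ψ : Site d → Fin d → Matrix n n ℂ) (F : Finset (Site d)),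
      energyNormW L j (flatCfg (d := d) (n := n)) ψ F ^ 2
        = curlSq (flatCfg (d := d) (n := n)) ψ F + (((L : ℝ) ^ j)⁻¹) ^ 2 * dirSq ψ F := by
    intro j ψ F
    have h1 : 0 ≤ curlSq (flatCfg (d := d) (n := n)) ψ F := by unfold curlSq; positivity
    have h2 : 0 ≤ dirSq ψ F := by unfold dirSq; positivity
    unfold NE3EnergyWeightedShapes.energyNormW
    exact Real.sq_sqrt (by positivity)
  rw [eW, eW, curlSq_flatCfg_sliceLift hd hL M φ, dirSq_sliceLift hL M φ]
  have hD0 : 0 ≤ dirSq φ (periodBox M) := by unfold dirSq; positivity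
  -- the bond part: `(L^{k+1})⁻²·L^{d−1} ≤ L^{d−2}·(L^k)⁻²`
  have hd1 : d - 1 = (d - 2) + 1 := by omega
  have hdm : (L : ℝ) ^ (d - 1) = (L : ℝ) ^ (d - 2) * L := by rw [hd1, pow_succ]
  have e1 : ((L : ℝ) ^ (k + 1))⁻¹ = ((L : ℝ) ^ k)⁻¹ * (L : ℝ)⁻¹ := by rw [pow_succ, mul_inv]
  have e2 : ((L : ℝ)⁻¹) ^ 2 * (L : ℝ) = (L : ℝ)⁻¹ := by
    rw [sq, mul_assoc, inv_mul_cancel₀ hL0.ne', mul_one]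
  have key : (((L : ℝ) ^ (k + 1))⁻¹) ^ 2 * ((L : ℝ) ^ (d - 1) * dirSq φ (periodBox M))
      ≤ (L : ℝ) ^ (d - 2) * ((((L : ℝ) ^ k)⁻¹) ^ 2 * dirSq φ (periodBox M)) := by
    rw [hdm, e1, mul_pow]
    have e3 : (((L : ℝ) ^ k)⁻¹) ^ 2 * ((L : ℝ)⁻¹) ^ 2 * ((L : ℝ) ^ (d - 2) * (L : ℝ) * dirSq φ (periodBox M))
        = (L : ℝ) ^ (d - 2) * ((((L : ℝ) ^ k)⁻¹) ^ 2 * dirSq φ (periodBox M)) * (((L : ℝ)⁻¹) ^ 2 * (L : ℝ)) := by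
      ring
    rw [e3, e2]
    have h1 : (L : ℝ)⁻¹ ≤ 1 := inv_le_one_of_one_le₀ hL1
    have h0 : 0 ≤ (L : ℝ) ^ (d - 2) * ((((L : ℝ) ^ k)⁻¹) ^ 2 * dirSq φ (periodBox M)) := by positivity
    calc (L : ℝ) ^ (d - 2) * ((((L : ℝ) ^ k)⁻¹) ^ 2 * dirSq φ (periodBox M)) * (L : ℝ)⁻¹
        ≤ (L : ℝ) ^ (d - 2) * ((((L : ℝ) ^ k)⁻¹) ^ 2 * dirSq φ (periodBox M)) * 1 := mul_le_mul_of_nonneg_left h1 h0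
      _ = (L : ℝ) ^ (d - 2) * ((((L : ℝ) ^ k)⁻¹) ^ 2 * dirSq φ (periodBox M)) := mul_one _
  rw [mul_add]
  linarith

/-- The same in the norm: `energyNormW L (k+1) 1 (sliceLift L φ) (periodBox (L·M)) ≤ √(L^{d−2})·energyNormW L k 1 φ (periodBox M)`.
[folklore] -/
theorem energyNormW_sliceLift_le (hd : 2 ≤ d) {L : ℕ} (hL : 1 ≤ L) (M k : ℕ) (φ : Site d → Fin d → Matrix n n ℂ) :
    energyNormW L (k + 1) (flatCfg (d := d) (n := n)) (sliceLift L φ) (periodBox (L * M))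
      ≤ Real.sqrt ((L : ℝ) ^ (d - 2)) * energyNormW L k (flatCfg (d := d) (n := n)) φ (periodBox M) := by
  have h := energyNormW_sliceLift_sq_le (n := n) hd hL M k φ
  have h0 := energyNormW_nonneg L (k + 1) (flatCfg (d := d) (n := n)) (sliceLift L φ) (periodBox (L * M))
  have h1 := energyNormW_nonneg L k (flatCfg (d := d) (n := n)) φ (periodBox M)
  have hL0 : (0 : ℝ) ≤ (L : ℝ) ^ (d - 2) := by positivity
  rw [← Real.sqrt_sq h0, ← Real.sqrt_sq h1, ← Real.sqrt_mul hL0]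
  exact Real.sqrt_le_sqrt h

end

end Summit.QuantumFields.BalabanUV.T4Continuum.NE3SliceLiftCurl
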